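import Literature.NumberTheory.Automorphic.InvolutionRingFixedDecomposition      -- ★ `HeisRing.fixedPart ∕ skewPart ∕ ringDecomp ∕ smulFixed ∕ smulSkew ∕ fixedModulus ∕ skewModulus`, `χ⁺ = χ⁻`, `χ⁻ = √‖·‖`
import Summits.HodgeConjecture.HodgeConjecture.Theorems.F0P3cStCharTSModulusShellCharacterVanishing   -- ★ B2 (ii) (this seat): `d×b` invariance, the vanishing; brings ★ B1
import HarnessLib

/-!
# F0 · P3c · line LH6 «StCharTS» — «INVOLUTION-RING POLAR SLICE★», FILE 1 «SHELLS» (ROAD «KEYS3-ANALYTIC», LEAD T15-03; brick B2 (i) of MEMO v3, first half): the fibrewise substitution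
# `y = l·η` on `R⁻` (Jacobian `χ⁻(l)`), and on `R⁺` the measure `ν⁺ = (√nrm)⁻¹·μ⁺`, preserved by fixed-unit homotheties, whose shell masses `ν⁺{A/Q < nrm ≤ A}` are `A`-independent, non-zero
# and finite [TateThesis1967 §2; WeilBNT1967 I §2, II §5, VII §2]

Cell `pub/hodgecm-mathlib`, crux H413 = `stmt-HodgeConjecture-24833` (lane `--supports … --as helper`), route HCCMUnconditional; seat F0P2-p06 (g21), ROAD «KEYS3-ANALYTIC» (LEAD
F0P3a-plan (g16) T15-03 «GO», fenced; MEMO `F0/P2/F0P2-p06/g21/MEMO-KEYS3-analytic-road.v3` §3).  THEOREMS ONLY (0 def ∕ 0 instance ∕ 0 notation ∕ 0 sorry).  FRAME = ★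
`InvolutionRingFixedDecomposition` (`R` commutative, locally compact Hausdorff second countable, Borel; `σ : R →+* R` continuous involution; `[Invertible (2 : R)]`; a `σ`-skew unit `δ`)
+ the «norm» `nrm : R → ℝ≥0` of ★ B2 (ii) (`nrm (u b) = ‖u‖_R nrm b`, `nrm 1 = 1`, measurable).  No field, no valuation, no residue characteristic in any STATEMENT (T15-03 (k1)).
-/

set_option autoImplicit false
-- the mandated namespace has the single-problem summit's repeated segment (`HodgeConjecture.HodgeConjecture`)
set_option linter.dupNamespace false

noncomputable section

open MeasureTheory Set
open scoped Pointwise NNReal ENNReal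
open Literature.NumberTheory.Automorphic.UnitaryGroup.HeisRing
open Summit.HodgeConjecture.HodgeConjecture.Cruxes.H413.F0P3cStCharTSHeightShellFundamentalDomain
open Summit.HodgeConjecture.HodgeConjecture.Cruxes.H413.F0P3cStCharTSModulusShellCharacterVanishing

namespace Summit.HodgeConjecture.HodgeConjecture.Cruxes.H413.F0P3cStCharTSInvolutionRingPolarSliceShells

/-! ## §0 The normalised «norm» -/

section Norm

variable {R : Type*} [CommRing R] [TopologicalSpace R] [IsTopologicalRing R] [LocallyCompactSpace R]
  {nrm : R → ℝ≥0} (hmul : ∀ (u : Rˣ) (b : R), nrm ((u : R) * b) = distribHaarChar R u * nrm b) (hone : nrm 1 = 1)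

include hmul hone in
/-- `nrm u = ‖u‖_R` on units (normalisation `nrm 1 = 1`). [cite: WeilBNT1967, Ch. I §2] -/
theorem nrm_units (u : Rˣ) : nrm (u : R) = distribHaarChar R u := by
  have h := hmul u 1
  rwa [mul_one, hone, mul_one] at h

include hmul hone in
/-- `nrm b > 0` for a unit `b`. [cite: WeilBNT1967, Ch. I §2] -/
theorem nrm_pos_of_isUnit {b : R} (hb : IsUnit b) : 0 < nrm b := by
  rw [← hb.unit_spec, nrm_units hmul hone]
  exact distribHaarChar_pos

include hmul hone in
/-- `nrm (s b) = nrm s · nrm b` for a unit `s`. [cite: WeilBNT1967, Ch. I §2] -/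
theorem nrm_mul_of_isUnit {s : R} (hs : IsUnit s) (b : R) : nrm (s * b) = nrm s * nrm b := by
  conv_lhs => rw [← hs.unit_spec]
  rw [hmul, ← nrm_units hmul hone, hs.unit_spec]

end Norm

variable {R : Type*} [CommRing R] [TopologicalSpace R] [IsTopologicalRing R] [LocallyCompactSpace R] [T2Space R] [SecondCountableTopology R]
  [MeasurableSpace R] [BorelSpace R] (σ : R →+* R) (hσ : ∀ x, σ (σ x) = x) (hσc : Continuous σ) [Invertible (2 : R)]

/-! ## §1 The fibrewise substitution `y = l · η` on `R⁻` -/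

section Skew

variable (μm : Measure (skewPart σ)) [μm.IsAddHaarMeasure] [μm.Regular]

omit [SecondCountableTopology R] [Invertible (2 : R)] in
/-- **`∫_{R⁻} g(y) dy = χ⁻(l) · ∫_{R⁻} g(l η) dη`** for a `σ`-fixed unit `l` (★ `map_smulSkew_eq`: `(l·)_* μ⁻ = χ⁻(l)⁻¹ μ⁻`). [cite: WeilBNT1967, Ch. I §2] -/
theorem integral_eq_skewModulus_smul_integral_comp_smulSkew {E : Type*} [NormedAddCommGroup E] [NormedSpace ℝ E]
    (l : Rˣ) (hl : σ (l : R) = l) (g : skewPart σ → E) :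
    ∫ y, g y ∂μm = (skewModulus σ hσc l hl : ℝ) • ∫ η, g (smulSkew σ l hl η) ∂μm := by
  haveI := locallyCompactSpace_skewPart σ hσc
  have hpos := skewModulus_pos σ hσc l hl
  have h1 : ∫ η, g (smulSkew σ l hl η) ∂μm = ∫ y, g y ∂(μm.map (smulSkew σ l hl)) :=
    (MeasureTheory.integral_map_equiv (smulSkew σ l hl).toHomeomorph.toMeasurableEquiv g).symm
  rw [h1, map_smulSkew_eq σ hσc l hl μm, integral_smul_nnreal_measure, ← NNReal.smul_def, smul_smul, mul_inv_cancel₀ hpos.ne', one_smul]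

omit [SecondCountableTopology R] [Invertible (2 : R)] in
/-- **`∫⁻_{R⁻} g(y) dy = χ⁻(l) · ∫⁻_{R⁻} g(l η) dη`** (lower-integral form, for Tonelli). [cite: WeilBNT1967, Ch. I §2] -/
theorem lintegral_eq_skewModulus_mul_lintegral_comp_smulSkew (l : Rˣ) (hl : σ (l : R) = l) (g : skewPart σ → ℝ≥0∞) :
    ∫⁻ y, g y ∂μm = (skewModulus σ hσc l hl : ℝ≥0∞) * ∫⁻ η, g (smulSkew σ l hl η) ∂μm := by
  haveI := locallyCompactSpace_skewPart σ hσc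
  have hpos := skewModulus_pos σ hσc l hl
  have h1 : ∫⁻ η, g (smulSkew σ l hl η) ∂μm = ∫⁻ y, g y ∂(μm.map (smulSkew σ l hl)) :=
    (MeasureTheory.lintegral_map_equiv g (smulSkew σ l hl).toHomeomorph.toMeasurableEquiv).symm
  rw [h1, map_smulSkew_eq σ hσc l hl μm, lintegral_smul_measure, ENNReal.smul_def, smul_eq_mul, ← mul_assoc, ← ENNReal.coe_mul,
    mul_inv_cancel₀ hpos.ne', ENNReal.coe_one, one_mul]

end Skew

/-! ## §2 The `s`-shell mass on `R⁺` against `χ⁺(s)⁻¹ ds` does not depend on the shell -/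

section Fixed

variable (μp : Measure (fixedPart σ)) [μp.IsAddHaarMeasure] [μp.Regular]
  {nrm : R → ℝ≥0} (hnm : Measurable nrm) (hmul : ∀ (u : Rˣ) (b : R), nrm ((u : R) * b) = distribHaarChar R u * nrm b) (hone : nrm 1 = 1)

include hσ hmul hone in
omit hnm in
/-- **`χ⁺(l) = √(nrm l)`** for a `σ`-fixed unit `l`, given a `σ`-skew unit `δ` (★ `fixedModulus_eq_skewModulus`, ★ `skewModulus_eq_sqrt`). [cite: WeilBNT1967, Ch. I §2] -/
theorem fixedModulus_eq_sqrt_nrm (δ : Rˣ) (hδ : σ (δ : R) = -δ) (l : Rˣ) (hl : σ (l : R) = l) :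
    fixedModulus σ hσc l hl = NNReal.sqrt (nrm (l : R)) := by
  rw [fixedModulus_eq_skewModulus σ hσc δ hδ l hl, skewModulus_eq_sqrt σ hσ hσc δ hδ l hl]
  congr 1
  exact (nrm_units hmul hone l).symm

include hσ hσc hnm hmul hone in
/-- **The measure `ν⁺ := (√nrm)⁻¹ · μ⁺` on `R⁺` is preserved by `s ↦ l s`** for every `σ`-fixed unit `l` (`χ⁺(l)⁻¹` from ★ `map_smulFixed_eq` cancels `√‖l‖⁻¹` from the density,
★ `χ⁺ = χ⁻ = √‖·‖`). [cite: TateThesis1967, §2.2] [cite: WeilBNT1967, Ch. VII §2] -/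
theorem measurePreserving_smulFixed_withDensity (δ : Rˣ) (hδ : σ (δ : R) = -δ) (l : Rˣ) (hl : σ (l : R) = l) :
    MeasurePreserving (smulFixed σ l hl)
      (μp.withDensity fun s => ((NNReal.sqrt (nrm (s : R)))⁻¹ : ℝ≥0)) (μp.withDensity fun s => ((NNReal.sqrt (nrm (s : R)))⁻¹ : ℝ≥0)) := by
  haveI := locallyCompactSpace_fixedPart σ hσc
  have hmeas : Measurable (smulFixed σ l hl) := (smulFixed σ l hl).continuous.measurable
  have hnm' : Measurable (fun s : fixedPart σ => nrm (s : R)) := hnm.comp measurable_subtype_coe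
  have hdens : Measurable (fun s : fixedPart σ => (((NNReal.sqrt (nrm (s : R)))⁻¹ : ℝ≥0) : ℝ≥0∞)) :=
    ((NNReal.continuous_sqrt.measurable.comp hnm').inv).coe_nnreal_ennreal
  have hq : 0 < fixedModulus σ hσc l hl := fixedModulus_pos σ hσc l hl
  have hsq : fixedModulus σ hσc l hl = NNReal.sqrt (distribHaarChar R l) := by
    rw [fixedModulus_eq_sqrt_nrm σ hσ hσc hmul hone δ hδ l hl, nrm_units hmul hone l]
  -- the density transforms by `√‖l‖ = χ⁺(l)`
  have h3 : ∀ s' : fixedPart σ, (((NNReal.sqrt (nrm (((smulFixed σ l hl).symm s' : fixedPart σ) : R)))⁻¹ : ℝ≥0) : ℝ≥0∞) =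
      ((fixedModulus σ hσc l hl : ℝ≥0) : ℝ≥0∞) * (((NNReal.sqrt (nrm (s' : R)))⁻¹ : ℝ≥0) : ℝ≥0∞) := by
    intro s'
    have hu : distribHaarChar R l⁻¹ = (distribHaarChar R l)⁻¹ := eq_inv_of_mul_eq_one_left (by rw [← map_mul, inv_mul_cancel, map_one])
    have hcoe : (((smulFixed σ l hl).symm s' : fixedPart σ) : R) = ((l⁻¹ : Rˣ) : R) * (s' : R) := rfl
    rw [hcoe, hmul, hu, NNReal.sqrt_mul, NNReal.sqrt_inv, mul_inv, inv_inv, hsq, ENNReal.coe_mul]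
  have hg : Measurable (fun s' : fixedPart σ => (((NNReal.sqrt (nrm (((smulFixed σ l hl).symm s' : fixedPart σ) : R)))⁻¹ : ℝ≥0) : ℝ≥0∞)) :=
    hdens.comp (smulFixed σ l hl).symm.continuous.measurable
  refine ⟨hmeas, ?_⟩
  ext t ht
  rw [Measure.map_apply hmeas ht, withDensity_apply _ (hmeas ht), withDensity_apply _ ht]
  have hfun : ((smulFixed σ l hl) ⁻¹' t).indicator (fun s : fixedPart σ => (((NNReal.sqrt (nrm (s : R)))⁻¹ : ℝ≥0) : ℝ≥0∞)) =
      fun s => t.indicator (fun s' : fixedPart σ => (((NNReal.sqrt (nrm (((smulFixed σ l hl).symm s' : fixedPart σ) : R)))⁻¹ : ℝ≥0) : ℝ≥0∞)) (smulFixed σ l hl s) := by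
    funext s
    rw [← Set.indicator_comp_right]
    congr 1
    funext s''
    simp only [Function.comp_apply, ContinuousAddEquiv.symm_apply_apply]
  calc ∫⁻ s in (smulFixed σ l hl) ⁻¹' t, (((NNReal.sqrt (nrm (s : R)))⁻¹ : ℝ≥0) : ℝ≥0∞) ∂μp
      = ∫⁻ s, ((smulFixed σ l hl) ⁻¹' t).indicator (fun s : fixedPart σ => (((NNReal.sqrt (nrm (s : R)))⁻¹ : ℝ≥0) : ℝ≥0∞)) s ∂μp :=
        (lintegral_indicator (hmeas ht) _).symm
    _ = ∫⁻ s, t.indicator (fun s' : fixedPart σ => (((NNReal.sqrt (nrm (((smulFixed σ l hl).symm s' : fixedPart σ) : R)))⁻¹ : ℝ≥0) : ℝ≥0∞)) (smulFixed σ l hl s) ∂μp := by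
        rw [hfun]
    _ = ∫⁻ s', t.indicator (fun s' : fixedPart σ => (((NNReal.sqrt (nrm (((smulFixed σ l hl).symm s' : fixedPart σ) : R)))⁻¹ : ℝ≥0) : ℝ≥0∞)) s' ∂(μp.map (smulFixed σ l hl)) :=
        (lintegral_map (hg.indicator ht) hmeas).symm
    _ = ((fixedModulus σ hσc l hl)⁻¹ : ℝ≥0) • ∫⁻ s' in t, (((NNReal.sqrt (nrm (((smulFixed σ l hl).symm s' : fixedPart σ) : R)))⁻¹ : ℝ≥0) : ℝ≥0∞) ∂μp := by
        rw [map_smulFixed_eq σ hσc l hl μp, lintegral_smul_measure, lintegral_indicator ht]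
    _ = ((fixedModulus σ hσc l hl)⁻¹ : ℝ≥0) • ∫⁻ s' in t, ((fixedModulus σ hσc l hl : ℝ≥0) : ℝ≥0∞) * (((NNReal.sqrt (nrm (s' : R)))⁻¹ : ℝ≥0) : ℝ≥0∞) ∂μp := by
        simp_rw [h3]
    _ = ∫⁻ s' in t, (((NNReal.sqrt (nrm (s' : R)))⁻¹ : ℝ≥0) : ℝ≥0∞) ∂μp := by
        rw [lintegral_const_mul _ hdens, ENNReal.smul_def, smul_eq_mul, ← mul_assoc, ← ENNReal.coe_mul, inv_mul_cancel₀ hq.ne',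
          ENNReal.coe_one, one_mul]

include hσ hσc hnm hmul hone in
/-- **The `ν⁺`-mass of the `s`-shell `{A/Q < nrm s ≤ A} ⊂ R⁺` does not depend on `A`**, `Q = ‖l₀‖_R > 1` for a `σ`-fixed unit `l₀`, `nrm > 0` `μ⁺`-a.e. (★ B1 `measure_heightShell_eq` for the
action of `(smulFixed l₀)^ℤ ≤ Perm R⁺`). [cite: WeilBNT1967, Ch. II §5 Prop. 12] [cite: TateThesis1967, §2.4] -/
theorem withDensity_fixedShell_eq (δ : Rˣ) (hδ : σ (δ : R) = -δ) (l₀ : Rˣ) (hl₀ : σ (l₀ : R) = l₀) (hQ : 1 < distribHaarChar R l₀)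
    (hpos : ∀ᵐ s ∂μp, 0 < nrm ((s : fixedPart σ) : R)) {A A' : ℝ} (hA : 0 < A) (hA' : 0 < A') :
    (μp.withDensity fun s => ((NNReal.sqrt (nrm (s : R)))⁻¹ : ℝ≥0)) ((fun s : fixedPart σ => (nrm (s : R) : ℝ)) ⁻¹' Set.Ioc (A / (distribHaarChar R l₀ : ℝ)) A) =
    (μp.withDensity fun s => ((NNReal.sqrt (nrm (s : R)))⁻¹ : ℝ≥0)) ((fun s : fixedPart σ => (nrm (s : R) : ℝ)) ⁻¹' Set.Ioc (A' / (distribHaarChar R l₀ : ℝ)) A') := by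
  haveI := locallyCompactSpace_fixedPart σ hσc
  -- the action of `γ := smulFixed l₀ ∈ Perm R⁺`
  set γ : Equiv.Perm (fixedPart σ) := (smulFixed σ l₀ hl₀).toEquiv with hγdef
  have hγ : ∀ s : fixedPart σ, γ • s = smulFixed σ l₀ hl₀ s := fun s => rfl
  have hγinv : ∀ s : fixedPart σ, γ⁻¹ • s = (smulFixed σ l₀ hl₀).symm s := fun s => rfl
  have hm : Measurable (fun s : fixedPart σ => γ • s) := by simp_rw [hγ]; exact (smulFixed σ l₀ hl₀).continuous.measurable
  have hm' : Measurable (fun s : fixedPart σ => γ⁻¹ • s) := by simp_rw [hγinv]; exact (smulFixed σ l₀ hl₀).symm.continuous.measurable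
  have hmp : MeasurePreserving (fun s : fixedPart σ => γ • s)
      (μp.withDensity fun s => ((NNReal.sqrt (nrm (s : R)))⁻¹ : ℝ≥0)) (μp.withDensity fun s => ((NNReal.sqrt (nrm (s : R)))⁻¹ : ℝ≥0)) := by
    simp_rw [hγ]; exact measurePreserving_smulFixed_withDensity σ hσ hσc μp hnm hmul hone δ hδ l₀ hl₀
  haveI := measurableConstSMul_zpowers hm hm'
  haveI := smulInvariantMeasure_zpowers _ hmp hm'
  have hscale : ∀ s : fixedPart σ, (nrm (((γ • s : fixedPart σ)) : R) : ℝ) = (distribHaarChar R l₀ : ℝ) * (nrm (s : R) : ℝ) := by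
    intro s
    rw [hγ, show ((smulFixed σ l₀ hl₀ s : fixedPart σ) : R) = (l₀ : R) * (s : R) from rfl, hmul, NNReal.coe_mul]
  have hposν : ∀ᵐ s ∂(μp.withDensity fun s => ((NNReal.sqrt (nrm (s : R)))⁻¹ : ℝ≥0)), 0 < (nrm ((s : fixedPart σ) : R) : ℝ) :=
    withDensity_absolutelyContinuous μp _ (hpos.mono fun s hs => by exact_mod_cast hs)
  have hnm' : Measurable (fun s : fixedPart σ => (nrm (s : R) : ℝ)) := NNReal.continuous_coe.measurable.comp (hnm.comp measurable_subtype_coe)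
  exact measure_heightShell_eq _ (by exact_mod_cast hQ) hscale hposν hA hA' (hnm' measurableSet_Ioc).nullMeasurableSet (hnm' measurableSet_Ioc).nullMeasurableSet


include hσ hσc hnm hmul hone in
/-- **The common shell mass `V'` is non-zero** (`ν⁺ ≠ 0` because `(√nrm)⁻¹ > 0` a.e.; then ★ B1 `measure_heightShell_ne_zero`). [cite: WeilBNT1967, Ch. II §5 Prop. 12] -/
theorem withDensity_fixedShell_ne_zero (δ : Rˣ) (hδ : σ (δ : R) = -δ) (l₀ : Rˣ) (hl₀ : σ (l₀ : R) = l₀) (hQ : 1 < distribHaarChar R l₀)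
    (hunit : ∀ᵐ s ∂μp, IsUnit ((s : fixedPart σ) : R)) {A : ℝ} (hA : 0 < A) :
    (μp.withDensity fun s => ((NNReal.sqrt (nrm (s : R)))⁻¹ : ℝ≥0)) ((fun s : fixedPart σ => (nrm (s : R) : ℝ)) ⁻¹' Set.Ioc (A / (distribHaarChar R l₀ : ℝ)) A) ≠ 0 := by
  haveI := locallyCompactSpace_fixedPart σ hσc
  set γ : Equiv.Perm (fixedPart σ) := (smulFixed σ l₀ hl₀).toEquiv with hγdef
  have hγ : ∀ s : fixedPart σ, γ • s = smulFixed σ l₀ hl₀ s := fun s => rfl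
  have hγinv : ∀ s : fixedPart σ, γ⁻¹ • s = (smulFixed σ l₀ hl₀).symm s := fun s => rfl
  have hm : Measurable (fun s : fixedPart σ => γ • s) := by simp_rw [hγ]; exact (smulFixed σ l₀ hl₀).continuous.measurable
  have hm' : Measurable (fun s : fixedPart σ => γ⁻¹ • s) := by simp_rw [hγinv]; exact (smulFixed σ l₀ hl₀).symm.continuous.measurable
  have hmp : MeasurePreserving (fun s : fixedPart σ => γ • s)
      (μp.withDensity fun s => ((NNReal.sqrt (nrm (s : R)))⁻¹ : ℝ≥0)) (μp.withDensity fun s => ((NNReal.sqrt (nrm (s : R)))⁻¹ : ℝ≥0)) := by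
    simp_rw [hγ]; exact measurePreserving_smulFixed_withDensity σ hσ hσc μp hnm hmul hone δ hδ l₀ hl₀
  haveI := measurableConstSMul_zpowers hm hm'
  haveI := smulInvariantMeasure_zpowers _ hmp hm'
  have hscale : ∀ s : fixedPart σ, (nrm (((γ • s : fixedPart σ)) : R) : ℝ) = (distribHaarChar R l₀ : ℝ) * (nrm (s : R) : ℝ) := by
    intro s
    rw [hγ, show ((smulFixed σ l₀ hl₀ s : fixedPart σ) : R) = (l₀ : R) * (s : R) from rfl, hmul, NNReal.coe_mul]
  have hposp : ∀ᵐ s ∂μp, 0 < nrm ((s : fixedPart σ) : R) := hunit.mono fun s hs => nrm_pos_of_isUnit hmul hone hs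
  have hposν : ∀ᵐ s ∂(μp.withDensity fun s => ((NNReal.sqrt (nrm (s : R)))⁻¹ : ℝ≥0)), 0 < (nrm ((s : fixedPart σ) : R) : ℝ) :=
    withDensity_absolutelyContinuous μp _ (hposp.mono fun s hs => by exact_mod_cast hs)
  have hnmp : Measurable (fun s : fixedPart σ => nrm (s : R)) := hnm.comp measurable_subtype_coe
  have hnm' : Measurable (fun s : fixedPart σ => (nrm (s : R) : ℝ)) := NNReal.continuous_coe.measurable.comp hnmp
  -- `ν⁺ ≠ 0`
  have hdensm : Measurable (fun s : fixedPart σ => (((NNReal.sqrt (nrm (s : R)))⁻¹ : ℝ≥0) : ℝ≥0∞)) :=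
    ((NNReal.continuous_sqrt.measurable.comp hnmp).inv).coe_nnreal_ennreal
  have hν0 : (μp.withDensity fun s => ((NNReal.sqrt (nrm (s : R)))⁻¹ : ℝ≥0)) ≠ 0 := by
    intro h0
    have h1 : ∫⁻ s, (((NNReal.sqrt (nrm ((s : fixedPart σ) : R)))⁻¹ : ℝ≥0) : ℝ≥0∞) ∂μp = 0 := by
      rw [← setLIntegral_univ, ← withDensity_apply _ MeasurableSet.univ, h0, Measure.coe_zero, Pi.zero_apply]
    rw [lintegral_eq_zero_iff hdensm] at h1
    have h2 : ∀ᵐ s ∂μp, (((NNReal.sqrt (nrm ((s : fixedPart σ) : R)))⁻¹ : ℝ≥0) : ℝ≥0∞) ≠ 0 := hposp.mono fun s hs => by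
      have : 0 < NNReal.sqrt (nrm ((s : fixedPart σ) : R)) := NNReal.sqrt_pos.2 hs
      exact_mod_cast (inv_pos.2 this).ne'
    have h3 : ∀ᵐ s ∂μp, False := (h1.and h2).mono fun s hs => hs.2 hs.1
    rw [Filter.eventually_false_iff_eq_bot, ae_eq_bot] at h3
    exact (isOpen_univ.measure_ne_zero μp Set.univ_nonempty) (by rw [h3]; rfl)
  exact measure_heightShell_ne_zero _ (by exact_mod_cast hQ) hscale hposν hA (hnm' measurableSet_Ioc).nullMeasurableSet hν0

include hσ hmul hone in
/-- For a `σ`-fixed unit `s`: `χ⁻(s) · (nrm s)⁻¹ = (√ nrm s)⁻¹` (★ `χ⁻ = √‖·‖`). [cite: WeilBNT1967, Ch. I §2] -/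
theorem skewModulus_mul_inv_nrm (δ : Rˣ) (hδ : σ (δ : R) = -δ) (l : Rˣ) (hl : σ (l : R) = l) :
    skewModulus σ hσc l hl * (nrm (l : R))⁻¹ = (NNReal.sqrt (nrm (l : R)))⁻¹ := by
  rw [skewModulus_eq_sqrt σ hσ hσc δ hδ l hl, ← nrm_units hmul hone l]
  have hn0 : nrm (l : R) ≠ 0 := (nrm_pos_of_isUnit hmul hone (Units.isUnit l)).ne'
  apply eq_inv_of_mul_eq_one_left
  rw [mul_right_comm, NNReal.mul_self_sqrt, mul_inv_cancel₀ hn0]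

omit [SecondCountableTopology R] [BorelSpace R] [Invertible (2 : R)] [μp.Regular] in
include hσc hnm in
/-- **The common shell mass `V'` is finite**: on the shell `nrm s > A/Q`, so the density `(√nrm s)⁻¹` is bounded, and the shell lies in the compact `{nrm ≤ A} ∩ R⁺`. [cite: WeilBNT1967, Ch. II §5] -/
theorem withDensity_fixedShell_lt_top (l₀ : Rˣ) (hQ : 1 < distribHaarChar R l₀) {A : ℝ} (hA : 0 < A) (hcpt : IsCompact {b : R | (nrm b : ℝ) ≤ A}) :
    (μp.withDensity fun s => ((NNReal.sqrt (nrm (s : R)))⁻¹ : ℝ≥0)) ((fun s : fixedPart σ => (nrm (s : R) : ℝ)) ⁻¹' Set.Ioc (A / (distribHaarChar R l₀ : ℝ)) A) < ⊤ := by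
  haveI := locallyCompactSpace_fixedPart σ hσc
  have hQ0 : (0 : ℝ) < (distribHaarChar R l₀ : ℝ) := by exact_mod_cast lt_trans zero_lt_one hQ
  have hnmp : Measurable (fun s : fixedPart σ => nrm (s : R)) := hnm.comp measurable_subtype_coe
  have hnm' : Measurable (fun s : fixedPart σ => (nrm (s : R) : ℝ)) := NNReal.continuous_coe.measurable.comp hnmp
  have hT : MeasurableSet ((fun s : fixedPart σ => (nrm (s : R) : ℝ)) ⁻¹' Set.Ioc (A / (distribHaarChar R l₀ : ℝ)) A) := hnm' measurableSet_Ioc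
  -- the shell is contained in a compact set
  have hTc : IsCompact ((Subtype.val : fixedPart σ → R) ⁻¹' {b : R | (nrm b : ℝ) ≤ A}) :=
    (isClosed_fixedPart σ hσc).isClosedEmbedding_subtypeVal.isCompact_preimage hcpt
  have hTfin : μp ((fun s : fixedPart σ => (nrm (s : R) : ℝ)) ⁻¹' Set.Ioc (A / (distribHaarChar R l₀ : ℝ)) A) < ⊤ :=
    lt_of_le_of_lt (measure_mono fun s hs => hs.2) hTc.measure_lt_top
  -- the density is bounded on the shell by `m₀⁻¹`, `m₀ = √(A/Q)`
  set m₀ : ℝ≥0 := NNReal.sqrt (Real.toNNReal (A / (distribHaarChar R l₀ : ℝ))) with hm₀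
  have hm₀pos : 0 < m₀ := NNReal.sqrt_pos.2 (Real.toNNReal_pos.2 (div_pos hA hQ0))
  have hle : ∀ s ∈ (fun s : fixedPart σ => (nrm (s : R) : ℝ)) ⁻¹' Set.Ioc (A / (distribHaarChar R l₀ : ℝ)) A,
      (((NNReal.sqrt (nrm ((s : fixedPart σ) : R)))⁻¹ : ℝ≥0) : ℝ≥0∞) ≤ ((m₀⁻¹ : ℝ≥0) : ℝ≥0∞) := by
    intro s hs
    have h1 : Real.toNNReal (A / (distribHaarChar R l₀ : ℝ)) < nrm (s : R) := (Real.toNNReal_lt_iff_lt_coe (le_of_lt (div_pos hA hQ0))).2 hs.1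
    have h2 : m₀ < NNReal.sqrt (nrm (s : R)) := NNReal.sqrt_lt_sqrt.2 h1
    exact_mod_cast (inv_anti₀ hm₀pos h2.le)
  rw [withDensity_apply _ hT]
  calc ∫⁻ s in (fun s : fixedPart σ => (nrm (s : R) : ℝ)) ⁻¹' Set.Ioc (A / (distribHaarChar R l₀ : ℝ)) A, (((NNReal.sqrt (nrm (s : R)))⁻¹ : ℝ≥0) : ℝ≥0∞) ∂μp
      ≤ ∫⁻ s in (fun s : fixedPart σ => (nrm (s : R) : ℝ)) ⁻¹' Set.Ioc (A / (distribHaarChar R l₀ : ℝ)) A, ((m₀⁻¹ : ℝ≥0) : ℝ≥0∞) ∂μp :=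
        setLIntegral_mono measurable_const hle
    _ = ((m₀⁻¹ : ℝ≥0) : ℝ≥0∞) * μp ((fun s : fixedPart σ => (nrm (s : R) : ℝ)) ⁻¹' Set.Ioc (A / (distribHaarChar R l₀ : ℝ)) A) := setLIntegral_const _ _
    _ < ⊤ := ENNReal.mul_lt_top ENNReal.coe_lt_top hTfin

end Fixed

end Summit.HodgeConjecture.HodgeConjecture.Cruxes.H413.F0P3cStCharTSInvolutionRingPolarSliceShells

end
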